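import Mathlib
import Summits.Ventures.PercRepro2.HCov
import Summits.Ventures.PercRepro2.PMK5Deg5K6
import Summits.Ventures.PercRepro2.BlockSubstLaw

/-!
# Block substitution, the explicit gluing: a skeleton with a mark-free two-terminal network on
every edge (blind cell PercRepro2, mine-2 g33)

The block substitutions of `BlockSubstConn.lean` are described by a structure on a given graph.
Here the glued graph is BUILT from its parts: a skeleton `ends' : E' → Sym2 V'` and, on every
skeleton edge `j`, a network with internal vertices `I j`, edges `F j` and incidence
`bends j : F j → Sym2 (V' ⊕ I j)` whose terminal ends are the ends of `j` (`IsNetworkOn`).  The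
glued graph `glueEnds` lives on `V' ⊕ Σ j, I j` with edges `Σ j, F j`; it is a block substitution
of the skeleton (`isBlockSubst_glue`), so

* **`HCov_glue`**: (HCOV) on the skeleton for every admissible weight vector gives (HCOV) on the
  glued graph for every admissible weight vector;
* **`HCov_glue_k6`** (THEOREM 32, glued form): **(HCOV) on `K₆` with an arbitrary mark-free
  two-terminal network on every edge**, every weight vector — THEOREM 30 carried to arbitrary `n`.
-/

namespace Summit.Ventures.PercRepro2

namespace BlockSubst

section Glue

variable {V' : Type*} {E' : Type*} {I : E' → Type*} {F : E' → Type*}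

/-- The vertex map of block `j` into the glued vertex type. -/
def glueVertex (j : E') : V' ⊕ I j → V' ⊕ Σ j, I j :=
  Sum.map id fun i => ⟨j, i⟩

/-- The glued graph: the edges of all blocks, with the internal vertices of block `j` tagged by
`j` and the terminals shared. -/
def glueEnds (bends : ∀ j, F j → Sym2 (V' ⊕ I j)) : (Σ j, F j) → Sym2 (V' ⊕ Σ j, I j) :=
  fun e => (bends e.1 e.2).map (glueVertex e.1)

/-- The block of a glued edge. -/
def glueBlk : (Σ j, F j) → E' := fun e => e.1

/-- The vertex set of block `j` in the glued graph: its two terminals and its internal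
vertices. -/
def glueVj (ends' : E' → Sym2 V') (j : E') : Set (V' ⊕ Σ j, I j) :=
  {x | (∃ k ∈ ends' j, x = Sum.inl k) ∨ ∃ i : I j, x = Sum.inr ⟨j, i⟩}

/-- **A network on the skeleton edge `j`**: every terminal end of one of its edges is an end of
`j` (its internal vertices are free). -/
def IsNetworkOn (ends' : E' → Sym2 V') (bends : ∀ j, F j → Sym2 (V' ⊕ I j)) : Prop :=
  ∀ j f, ∀ k : V', Sum.inl k ∈ bends j f → k ∈ ends' j

/-- A glued vertex in the image of `glueVertex j` is a terminal end of `j` or internal to `j`. -/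
lemma mem_glueVj_of_mem_map {ends' : E' → Sym2 V'} {bends : ∀ j, F j → Sym2 (V' ⊕ I j)}
    (hN : IsNetworkOn ends' bends) (j : E') (f : F j) {x : V' ⊕ Σ j, I j}
    (hx : x ∈ (bends j f).map (glueVertex j)) : x ∈ glueVj ends' j := by
  rw [Sym2.mem_map] at hx
  obtain ⟨y, hy, rfl⟩ := hx
  rcases y with k | i
  · exact Or.inl ⟨k, hN j f k hy, rfl⟩
  · exact Or.inr ⟨i, rfl⟩

/-- **The glued graph is a block substitution of the skeleton** along `Sum.inl`. -/
theorem isBlockSubst_glue (ends' : E' → Sym2 V') (bends : ∀ j, F j → Sym2 (V' ⊕ I j))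
    (hN : IsNetworkOn ends' bends) :
    IsBlockSubst (glueEnds bends) ends' Sum.inl glueBlk (glueVj ends') where
  ends_mem e x hx := mem_glueVj_of_mem_map hN e.1 e.2 hx
  term_mem j k hk := Or.inl ⟨k, hk, rfl⟩
  inter_terms j j' hjj x hx hx' := by
    rcases hx with ⟨k, hk, rfl⟩ | ⟨i, rfl⟩
    · exact ⟨k, hk, rfl⟩
    · rcases hx' with ⟨k, _, h⟩ | ⟨i', h⟩
      · exact absurd h (by simp)
      · exact absurd (Sigma.mk.inj_iff.1 (Sum.inr_injective h)).1 hjj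
  term_only j k hk := by
    rcases hk with ⟨k', hk', h⟩ | ⟨i, h⟩
    · rw [Sum.inl_injective h]
      exact hk'
    · exact absurd h (by simp)
  q_inj := Sum.inl_injective

variable [Fintype E'] [DecidableEq E'] [∀ j, Fintype (F j)] [∀ j, DecidableEq (F j)]
  {R : Type*} [Field R] [LinearOrder R] [IsStrictOrderedRing R]

/-- **(HCOV) on a glued graph** from (HCOV) on its skeleton for every admissible weight
vector. -/
theorem HCov_glue (ends' : E' → Sym2 V') (bends : ∀ j, F j → Sym2 (V' ⊕ I j))
    (hN : IsNetworkOn ends' bends) (o a₁ a₂ a₃ b : V')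
    (hsk : ∀ r : E' → R, IsProbVec r → CovForm.HCov r ends' o a₁ a₂ a₃ b)
    (p : (Σ j, F j) → R) (hp : IsProbVec p) :
    CovForm.HCov p (glueEnds bends) (Sum.inl o) (Sum.inl a₁) (Sum.inl a₂) (Sum.inl a₃)
      (Sum.inl b) :=
  HCov_of_skeleton (isBlockSubst_glue ends' bends hN) o a₁ a₂ a₃ b hsk p hp

end Glue

section GlueK6

variable {I : Fin 15 → Type*} {F : Fin 15 → Type*} [∀ j, Fintype (F j)] [∀ j, DecidableEq (F j)]
  {R : Type*} [Field R] [LinearOrder R] [IsStrictOrderedRing R]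

/-- **THEOREM 32, glued form — (HCOV) on `K₆` with an arbitrary mark-free two-terminal network
on every edge**: for every family of networks `bends j` on the fifteen edges of `K₆`
(`Deg5.ends15`; internal vertices `I j`, edges `F j`, the terminal ends of every edge among the
two ends of `j`) and every admissible weight vector on the glued edges, (HCOV) holds at the marks
`o = 0, a₁ = 1, a₂ = 2, a₃ = 5, b = 4` (THEOREM 30 on the skeleton). -/
theorem HCov_glue_k6 (bends : ∀ j, F j → Sym2 (Fin 6 ⊕ I j))
    (hN : IsNetworkOn Deg5.ends15 bends) (p : (Σ j, F j) → R) (hp : IsProbVec p) :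
    CovForm.HCov p (glueEnds bends) (Sum.inl 0) (Sum.inl 1) (Sum.inl 2) (Sum.inl 5) (Sum.inl 4) :=
  HCov_glue Deg5.ends15 bends hN 0 1 2 5 4 (fun r hr => Deg5.HCov_k6 r hr) p hp

end GlueK6

section Subdivision

variable {V' : Type*} {E' : Type*}

/-- The vertices of the path with `n` internal vertices from the terminal `a` to the terminal
`b`: `0 ↦ a`, `n + 1 ↦ b`, `i + 1 ↦` the internal vertex `i`. -/
def pathVertex (a b : V') (n : ℕ) : Fin (n + 2) → V' ⊕ Fin n :=
  Fin.cases (Sum.inl a) (Fin.lastCases (Sum.inl b) fun i => Sum.inr i)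

/-- The edges of the path: edge `f` joins the vertices `f` and `f + 1`. -/
def pathEnds (a b : V') (n : ℕ) (f : Fin (n + 1)) : Sym2 (V' ⊕ Fin n) :=
  s(pathVertex a b n f.castSucc, pathVertex a b n f.succ)

/-- A terminal vertex of the path is `a` or `b`. -/
lemma pathVertex_inl (a b : V') (n : ℕ) (i : Fin (n + 2)) (k : V')
    (h : pathVertex a b n i = Sum.inl k) : k = a ∨ k = b := by
  revert h
  refine Fin.cases ?_ (fun i => ?_) i
  · intro h
    simp only [pathVertex, Fin.cases_zero, Sum.inl.injEq] at h
    exact Or.inl h.symm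
  · refine Fin.lastCases ?_ (fun i => ?_) i
    · intro h
      simp only [pathVertex, Fin.cases_succ, Fin.lastCases_last, Sum.inl.injEq] at h
      exact Or.inr h.symm
    · intro h
      simp only [pathVertex, Fin.cases_succ, Fin.lastCases_castSucc, reduceCtorEq] at h

/-- The paths are networks on the skeleton edges. -/
lemma isNetworkOn_path (ends' : E' → Sym2 V') (a b : E' → V') (hab : ∀ j, ends' j = s(a j, b j))
    (n : E' → ℕ) : IsNetworkOn ends' fun j => pathEnds (a j) (b j) (n j) := by
  intro j f k hk
  rw [hab, Sym2.mem_iff]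
  simp only [pathEnds, Sym2.mem_iff] at hk
  rcases hk with h | h
  · rcases pathVertex_inl _ _ _ _ _ h.symm with rfl | rfl <;> simp
  · rcases pathVertex_inl _ _ _ _ _ h.symm with rfl | rfl <;> simp

/-- **The subdivision of the skeleton**: edge `j = {a j, b j}` replaced by a path with `n j`
internal vertices. -/
def subdivEnds (a b : E' → V') (n : E' → ℕ) :
    (Σ j, Fin (n j + 1)) → Sym2 (V' ⊕ Σ j, Fin (n j)) :=
  glueEnds fun j => pathEnds (a j) (b j) (n j)

variable [Fintype E'] [DecidableEq E'] {R : Type*} [Field R] [LinearOrder R]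
  [IsStrictOrderedRing R]

/-- **(HCOV) on every subdivision of a skeleton** satisfying (HCOV) for every admissible weight
vector. -/
theorem HCov_subdivision (ends' : E' → Sym2 V') (a b : E' → V') (hab : ∀ j, ends' j = s(a j, b j))
    (n : E' → ℕ) (o a₁ a₂ a₃ bm : V')
    (hsk : ∀ r : E' → R, IsProbVec r → CovForm.HCov r ends' o a₁ a₂ a₃ bm)
    (p : (Σ j, Fin (n j + 1)) → R) (hp : IsProbVec p) :
    CovForm.HCov p (subdivEnds a b n) (Sum.inl o) (Sum.inl a₁) (Sum.inl a₂) (Sum.inl a₃)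
      (Sum.inl bm) :=
  HCov_glue ends' _ (isNetworkOn_path ends' a b hab n) o a₁ a₂ a₃ bm hsk p hp

end Subdivision

section SubdivisionK6

variable {R : Type*} [Field R] [LinearOrder R] [IsStrictOrderedRing R]

/-- **(HCOV) on every subdivision of `K₆`**: edge `j` of `K₆` replaced by a path with `n j`
internal vertices, every `n : Fin 15 → ℕ`, every admissible weight vector on the subdivided
edges, the marks at `o = 0, a₁ = 1, a₂ = 2, a₃ = 5, b = 4` (THEOREM 30 on the skeleton). -/
theorem HCov_subdivision_k6 (n : Fin 15 → ℕ) (p : (Σ j, Fin (n j + 1)) → R) (hp : IsProbVec p) :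
    CovForm.HCov p (subdivEnds (fun j => (Deg5.edge15 j).1) (fun j => (Deg5.edge15 j).2) n)
      (Sum.inl 0) (Sum.inl 1) (Sum.inl 2) (Sum.inl 5) (Sum.inl 4) :=
  HCov_subdivision Deg5.ends15 _ _ (fun _ => rfl) n 0 1 2 5 4 (fun r hr => Deg5.HCov_k6 r hr) p hp

end SubdivisionK6

end BlockSubst

end Summit.Ventures.PercRepro2
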